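import Literature.Analysis.FluidPDE.Wei2016WeightedBalance
import Literature.Analysis.FluidPDE.TaoClassQuotientBalance
import Literature.Analysis.FluidPDE.HouLiSpaceTime
import Literature.Analysis.FluidPDE.AxisymPhiFourEnergy
import Literature.Analysis.FluidPDE.AxisymQuotientBounds
import Literature.Analysis.FluidPDE.AxisymOuterBounds
import Literature.Analysis.FluidPDE.AxisymOmegaThetaEnergy
import HarnessLib

/-!
# Time balances of `‖v^θ‖⁴_{L⁴} = ∫ r⁴Φ⁴` and `‖ω^θ‖²_{L²} = ∫ r²Ω²` in Tao's class

Analysis/FluidPDE proof file (theorems only; no definitions, no named facts) on the way to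
`Literature.Analysis.FluidPDE.Wei2016_logModulus_regularity`
(`LeiZhang2017AxisymmetricCriteria.lean`). The end of the proof of Wei 2016, Thm. 1.1 /
Lei–Zhang 2017, §3 (arXiv:1505.02628, p. 9) integrates in time the `L⁴` inequality of `v^θ`
and the `L²` inequality of `ω^θ` ("Gronwall's inequality"). In Tao's class
(`IsTaoSolutionOn`: smooth, all Sobolev norms of `u` and `∂ₜu` bounded on the slab) the
energies `E₄(t) = ∫ (x₀²+x₁²)²Φ(t)⁴ = ‖v^θ(t)‖⁴_{L⁴}`, `P₄(t) = ∫ (x₀²+x₁²)Φ(t)⁴ = ‖r⁻¹v^θ(t)²‖²`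
and `E_ω(t) = ∫ (x₀²+x₁²)Ω(t)² = ‖ω^θ(t)‖²` (`Φ = angVelQuot`, `Ω = angVortQuot`) are
continuous on `[0, T]` and obey the fundamental theorem of calculus with the densities
`∫ 4(x₀²+x₁²)²Φ³Φ'` and `∫ 2(x₀²+x₁²)ΩΩ'` (`Φ' = angVelQuot (∂ₜu)`, `Ω' = angVortQuot (∂ₜu)`):

* `IsTaoSolutionOn.swirlFour_balance` — `E₄(b) = E₄(0) + ∫₀ᵇ ∫ 4(x₀²+x₁²)²Φ³Φ'`, continuity,
  integrability of the density;
* `IsTaoSolutionOn.continuousOn_rhoPhiFour` — continuity of `P₄`;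
* `IsTaoSolutionOn.omegaTheta_balance` — `E_ω(b) = E_ω(0) + ∫₀ᵇ ∫ 2(x₀²+x₁²)ΩΩ'`, continuity,
  integrability of the density.

All three are instances of `Wei2016.weighted_sq_balance` (jointly smooth family, static weight,
uniform `L²` bounds): `E₄` with `g = (x₀²+x₁²)Φ²` and weight `1` (`(x₀²+x₁²)Φ² ≤ |u|²`,
`(x₀²+x₁²)Φ'² ≤ |∂ₜu|²`), `P₄` with `g = Φ²` and weight `r` (`|Φ| ≤ |Du|`), `E_ω` with `g = Ω`
and weight `r` (`r|Ω| ≤ |ω| ≤ ‖curl‖|Du|`).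

## References

* Z. Lei, Q. S. Zhang, arXiv:1505.02628, §3 p. 9. [LeiZhang2017]
* D. Wei, arXiv:1508.03318, end of the proof of Thm. 1.1. [Wei2016]
-/

noncomputable section

open MeasureTheory Set Function Filter Topology InnerProductSpace
open scoped RealInnerProductSpace ContDiff ENNReal NNReal

namespace Literature.Analysis.FluidPDE

variable {T ν : ℝ} {u₀ : EuclideanSpace ℝ (Fin 3) → EuclideanSpace ℝ (Fin 3)}
  {u : ℝ → EuclideanSpace ℝ (Fin 3) → EuclideanSpace ℝ (Fin 3)} {p : ℝ → EuclideanSpace ℝ (Fin 3) → ℝ}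

/-- `‖f x‖ₑ² ≤ ofReal (c²) ‖g x‖ₑ²` from `|f x| ≤ c ‖g x‖`, `0 ≤ c`. [folklore] -/
private theorem enorm_sq_le_of_abs_le {F : Type*} [NormedAddCommGroup F] {a : ℝ} {b : F} {c : ℝ}
    (h : |a| ≤ c * ‖b‖) : ‖a‖ₑ ^ 2 ≤ ENNReal.ofReal (c ^ 2) * ‖b‖ₑ ^ 2 := by
  rw [Real.enorm_eq_ofReal_abs, ← ofReal_norm, ← ENNReal.ofReal_pow (abs_nonneg _),
    ← ENNReal.ofReal_pow (norm_nonneg _), ← ENNReal.ofReal_mul (sq_nonneg _), ← mul_pow]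
  exact ENNReal.ofReal_le_ofReal (pow_le_pow_left₀ (abs_nonneg _) h 2)

/-- `∫⁻ ‖f‖ₑ² ≤ ofReal (c²) C` from `|f| ≤ c‖g‖` and `∫⁻ ‖g‖ₑ² ≤ C`. [folklore] -/
private theorem lintegral_enorm_sq_le_of_abs_le {F : Type*} [NormedAddCommGroup F]
    {f : EuclideanSpace ℝ (Fin 3) → ℝ} {g : EuclideanSpace ℝ (Fin 3) → F} {c : ℝ} {C : ℝ≥0∞}
    (h : ∀ x, |f x| ≤ c * ‖g x‖) (hg : ∫⁻ x, ‖g x‖ₑ ^ 2 ≤ C) :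
    ∫⁻ x, ‖f x‖ₑ ^ 2 ≤ ENNReal.ofReal (c ^ 2) * C := by
  calc ∫⁻ x, ‖f x‖ₑ ^ 2 ≤ ∫⁻ x, ENNReal.ofReal (c ^ 2) * ‖g x‖ₑ ^ 2 :=
        lintegral_mono fun x => enorm_sq_le_of_abs_le (h x)
    _ = ENNReal.ofReal (c ^ 2) * ∫⁻ x, ‖g x‖ₑ ^ 2 := lintegral_const_mul' _ _ ENNReal.ofReal_ne_top
    _ ≤ ENNReal.ofReal (c ^ 2) * C := by gcongr

/-- The Sobolev bounds of Tao's class at level `0` and `1`, for `u` and `∂ₜu`, in the form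
`∫⁻ ‖u‖ₑ², ∫⁻ ‖Du‖ₑ², ∫⁻ ‖∂ₜu‖ₑ², ∫⁻ ‖D∂ₜu‖ₑ² ≤ C` uniformly on `[0, T]`. [folklore] -/
theorem IsTaoSolutionOn.exists_lintegral_sq_le_four (h : IsTaoSolutionOn T ν u₀ u p) :
    ∃ C : ℝ≥0, (∀ t ∈ Icc 0 T, ∫⁻ x, ‖u t x‖ₑ ^ 2 ≤ C) ∧
      (∀ t ∈ Icc 0 T, ∫⁻ x, ‖fderiv ℝ (u t) x‖ₑ ^ 2 ≤ C) ∧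
      (∀ t ∈ Icc 0 T, ∫⁻ x, ‖FluidPDE.timeDerivWithin (Icc 0 T) u t x‖ₑ ^ 2 ≤ C) ∧
      (∀ t ∈ Icc 0 T, ∫⁻ x, ‖fderiv ℝ (FluidPDE.timeDerivWithin (Icc 0 T) u t) x‖ₑ ^ 2 ≤ C) := by
  obtain ⟨C0, hC0⟩ := h.sobolev 0
  obtain ⟨C1, hC1⟩ := h.sobolev 1
  obtain ⟨D0, hD0⟩ := h.sobolev_dt 0
  obtain ⟨D1, hD1⟩ := h.sobolev_dt 1
  have e0 : C0 ≤ C0 + C1 + D0 + D1 := le_add_right (le_add_right (le_add_right le_rfl))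
  have e1 : C1 ≤ C0 + C1 + D0 + D1 := le_add_right (le_add_right (le_add_left le_rfl))
  have e2 : D0 ≤ C0 + C1 + D0 + D1 := le_add_right (le_add_left le_rfl)
  have e3 : D1 ≤ C0 + C1 + D0 + D1 := le_add_left le_rfl
  refine ⟨C0 + C1 + D0 + D1, fun t ht => ?_, fun t ht => ?_, fun t ht => ?_, fun t ht => ?_⟩
  · have := hC0 t ht
    calc ∫⁻ x, ‖u t x‖ₑ ^ 2 = ∫⁻ x, ‖iteratedFDeriv ℝ 0 (u t) x‖ₑ ^ 2 :=
          lintegral_congr fun x => by rw [← ofReal_norm, ← norm_iteratedFDeriv_zero (𝕜 := ℝ), ofReal_norm]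
      _ ≤ C0 := this
      _ ≤ _ := ENNReal.coe_le_coe.2 e0
  · have := hC1 t ht
    calc ∫⁻ x, ‖fderiv ℝ (u t) x‖ₑ ^ 2 = ∫⁻ x, ‖iteratedFDeriv ℝ 1 (u t) x‖ₑ ^ 2 :=
          lintegral_congr fun x => by
            rw [← ofReal_norm, ← norm_iteratedFDeriv_zero (𝕜 := ℝ) (f := fderiv ℝ (u t)),
              norm_iteratedFDeriv_fderiv, ofReal_norm]
      _ ≤ C1 := this
      _ ≤ _ := ENNReal.coe_le_coe.2 e1
  · have := hD0 t ht
    calc ∫⁻ x, ‖FluidPDE.timeDerivWithin (Icc 0 T) u t x‖ₑ ^ 2 =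
        ∫⁻ x, ‖iteratedFDeriv ℝ 0 (FluidPDE.timeDerivWithin (Icc 0 T) u t) x‖ₑ ^ 2 :=
          lintegral_congr fun x => by rw [← ofReal_norm, ← norm_iteratedFDeriv_zero (𝕜 := ℝ), ofReal_norm]
      _ ≤ D0 := this
      _ ≤ _ := ENNReal.coe_le_coe.2 e2
  · have := hD1 t ht
    calc ∫⁻ x, ‖fderiv ℝ (FluidPDE.timeDerivWithin (Icc 0 T) u t) x‖ₑ ^ 2 =
        ∫⁻ x, ‖iteratedFDeriv ℝ 1 (FluidPDE.timeDerivWithin (Icc 0 T) u t) x‖ₑ ^ 2 :=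
          lintegral_congr fun x => by
            rw [← ofReal_norm, ← norm_iteratedFDeriv_zero (𝕜 := ℝ) (f := fderiv ℝ (FluidPDE.timeDerivWithin (Icc 0 T) u t)),
              norm_iteratedFDeriv_fderiv, ofReal_norm]
      _ ≤ D1 := this
      _ ≤ _ := ENNReal.coe_le_coe.2 e3

set_option maxHeartbeats 800000 in
/-- **The `‖v^θ‖⁴_{L⁴}` balance in Tao's class**: with `Φ(t) = angVelQuot (u t)`,
`Φ'(t) = angVelQuot (∂ₜu t)`, the function `E₄(t) = ∫ (x₀²+x₁²)²Φ(t)⁴` is continuous on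
`[0, T]`, its density `∫ 4(x₀²+x₁²)²Φ³Φ'` is integrable on `(0, T)`, and
`E₄(b) = E₄(0) + ∫₀ᵇ ∫ 4(x₀²+x₁²)²Φ³Φ'` for `b ∈ (0, T]`. [cite: LeiZhang2017, §3 p. 9] -/
theorem IsTaoSolutionOn.swirlFour_balance (h : IsTaoSolutionOn T ν u₀ u p) (hT : 0 < T)
    (hax : ∀ t ∈ Icc 0 T, IsAxisymmetric (u t)) :
    IntegrableOn (fun t => ∫ x : EuclideanSpace ℝ (Fin 3), 4 * ((x 0 ^ 2 + x 1 ^ 2) ^ 2 * angVelQuot (u t) x ^ 3 *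
        angVelQuot (FluidPDE.timeDerivWithin (Icc 0 T) u t) x)) (Ioo 0 T) ∧
    ContinuousOn (fun t => ∫ x : EuclideanSpace ℝ (Fin 3), (x 0 ^ 2 + x 1 ^ 2) ^ 2 * angVelQuot (u t) x ^ 4) (Icc 0 T) ∧
    ∀ b ∈ Ioc 0 T, ∫ x : EuclideanSpace ℝ (Fin 3), (x 0 ^ 2 + x 1 ^ 2) ^ 2 * angVelQuot (u b) x ^ 4 =
      (∫ x : EuclideanSpace ℝ (Fin 3), (x 0 ^ 2 + x 1 ^ 2) ^ 2 * angVelQuot (u 0) x ^ 4) +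
        ∫ t in (0 : ℝ)..b, ∫ x : EuclideanSpace ℝ (Fin 3), 4 * ((x 0 ^ 2 + x 1 ^ 2) ^ 2 * angVelQuot (u t) x ^ 3 *
          angVelQuot (FluidPDE.timeDerivWithin (Icc 0 T) u t) x) := by
  have hU : UniqueDiffOn ℝ (Icc 0 T) := uniqueDiffOn_Icc hT
  have hcv : Convex ℝ (Icc (0 : ℝ) T) := convex_Icc 0 T
  have hcl := h.classical
  have hsm : IsSmoothSpaceTimeOn (Icc 0 T) u := hcl.smooth_velocity
  have hΦf : IsSmoothSpaceTimeOn (Icc 0 T) fun t => angVelQuot (u t) := hsm.angVelQuot_family hcv hU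
  have hΦ' : ∀ t ∈ Icc 0 T, ∀ x, FluidPDE.timeDerivWithin (Icc 0 T) (fun s => angVelQuot (u s)) t x =
      angVelQuot (FluidPDE.timeDerivWithin (Icc 0 T) u t) x := fun t ht x =>
    hsm.timeDerivWithin_angVelQuot hcv hU hax ht x
  -- the family `G t x = (x₀²+x₁²) Φ²`
  set G : ℝ → EuclideanSpace ℝ (Fin 3) → ℝ := fun t x => (x 0 ^ 2 + x 1 ^ 2) * (angVelQuot (u t) x * angVelQuot (u t) x)
    with hG
  have hGsm : IsSmoothSpaceTimeOn (Icc 0 T) G :=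
    (isSmoothSpaceTimeOn_const_time (contDiff_horizSq (n := ∞)) _).mul (hΦf.mul hΦf)
  have hG' : ∀ t ∈ Icc 0 T, ∀ x, FluidPDE.timeDerivWithin (Icc 0 T) G t x =
      (x 0 ^ 2 + x 1 ^ 2) * (2 * angVelQuot (u t) x * angVelQuot (FluidPDE.timeDerivWithin (Icc 0 T) u t) x) := by
    intro t ht x
    have hd := hΦf.hasDerivWithinAt_timeDerivWithin hU ht x
    rw [hΦ' t ht x] at hd
    have h2 : HasDerivWithinAt (fun s => (x 0 ^ 2 + x 1 ^ 2) * (angVelQuot (u s) x * angVelQuot (u s) x))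
        ((x 0 ^ 2 + x 1 ^ 2) * (angVelQuot (FluidPDE.timeDerivWithin (Icc 0 T) u t) x * angVelQuot (u t) x +
          angVelQuot (u t) x * angVelQuot (FluidPDE.timeDerivWithin (Icc 0 T) u t) x)) (Icc 0 T) t :=
      (hd.mul hd).const_mul _
    rw [timeDerivWithin_apply, h2.derivWithin (hU t ht)]
    ring
  -- uniform bounds
  obtain ⟨B, hB0, hB⟩ := h.exists_bound_velocity
  obtain ⟨C, hC0, -, hCt0, -⟩ := h.exists_lintegral_sq_le_four
  have hws : ∀ t ∈ Icc 0 T, ContDiff ℝ 2 (FluidPDE.timeDerivWithin (Icc 0 T) u t) := fun t ht =>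
    (hsm.contDiff_timeDerivWithin_slice hU ht).of_le (by norm_cast)
  have hwax : ∀ t ∈ Icc 0 T, IsAxisymmetric (FluidPDE.timeDerivWithin (Icc 0 T) u t) := fun t ht =>
    hsm.isAxisymmetric_timeDerivWithin hax ht
  have hu2 : ∀ t ∈ Icc 0 T, ContDiff ℝ 2 (u t) := fun t ht => (hcl.contDiff_velocity ht).of_le (by norm_cast)
  have hρΦ : ∀ t ∈ Icc 0 T, ∀ x : EuclideanSpace ℝ (Fin 3), (x 0 ^ 2 + x 1 ^ 2) * angVelQuot (u t) x ^ 2 ≤ B ^ 2 :=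
    fun t ht x => ((hax t ht).horizSq_mul_angVelQuot_sq_le (hu2 t ht) x).trans
      (pow_le_pow_left₀ (norm_nonneg _) (hB t ht x) 2)
  have hGb : ∀ t ∈ Icc 0 T, ∀ x, |G t x| ≤ B * ‖u t x‖ := by
    intro t ht x
    have h1 := (hax t ht).horizSq_mul_angVelQuot_sq_le (hu2 t ht) x
    have h2 := hρΦ t ht x
    have hGx : G t x = (x 0 ^ 2 + x 1 ^ 2) * angVelQuot (u t) x ^ 2 := by simp only [hG]; ring
    have ha0 : 0 ≤ (x 0 ^ 2 + x 1 ^ 2) * angVelQuot (u t) x ^ 2 := by positivity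
    rw [hGx, abs_of_nonneg ha0]
    have hsq : ((x 0 ^ 2 + x 1 ^ 2) * angVelQuot (u t) x ^ 2) ^ 2 ≤ (B * ‖u t x‖) ^ 2 := by
      rw [mul_pow B, pow_two ((x 0 ^ 2 + x 1 ^ 2) * angVelQuot (u t) x ^ 2)]
      exact mul_le_mul h2 h1 ha0 (sq_nonneg _)
    exact (pow_le_pow_iff_left₀ ha0 (by positivity) two_ne_zero).1 hsq
  have hG'b : ∀ t ∈ Icc 0 T, ∀ x, |FluidPDE.timeDerivWithin (Icc 0 T) G t x| ≤
      (2 * B) * ‖FluidPDE.timeDerivWithin (Icc 0 T) u t x‖ := by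
    intro t ht x
    rw [hG' t ht x]
    have h1 := (hwax t ht).horizSq_mul_angVelQuot_sq_le (hws t ht) x
    have h2 := hρΦ t ht x
    have hsq : ((x 0 ^ 2 + x 1 ^ 2) * (2 * angVelQuot (u t) x * angVelQuot (FluidPDE.timeDerivWithin (Icc 0 T) u t) x)) ^ 2 ≤
        ((2 * B) * ‖FluidPDE.timeDerivWithin (Icc 0 T) u t x‖) ^ 2 := by
      have : ((x 0 ^ 2 + x 1 ^ 2) * (2 * angVelQuot (u t) x * angVelQuot (FluidPDE.timeDerivWithin (Icc 0 T) u t) x)) ^ 2 =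
          4 * ((x 0 ^ 2 + x 1 ^ 2) * angVelQuot (u t) x ^ 2) *
            ((x 0 ^ 2 + x 1 ^ 2) * angVelQuot (FluidPDE.timeDerivWithin (Icc 0 T) u t) x ^ 2) := by ring
      rw [this, mul_pow, mul_pow]
      have h4 : (4 : ℝ) * ((x 0 ^ 2 + x 1 ^ 2) * angVelQuot (u t) x ^ 2) ≤ 2 ^ 2 * B ^ 2 := by linarith
      exact mul_le_mul h4 h1 (by positivity) (by positivity)
    exact abs_le.2 (abs_le_of_sq_le_sq' hsq (by positivity))
  have hC₀ : ∀ t ∈ Icc 0 T, ∫⁻ x, ‖(1 : ℝ) * G t x‖ₑ ^ 2 ≤ ((Real.toNNReal (B ^ 2) * C : ℝ≥0) : ℝ≥0∞) := by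
    intro t ht
    simp only [one_mul]
    have := lintegral_enorm_sq_le_of_abs_le (hGb t ht) (hC0 t ht)
    have e : (((B ^ 2).toNNReal * C : ℝ≥0) : ℝ≥0∞) = ENNReal.ofReal (B ^ 2) * C := by
      rw [ENNReal.coe_mul]; rfl
    rw [e]; exact this
  have hC₁ : ∀ t ∈ Icc 0 T, ∫⁻ x, ‖(1 : ℝ) * FluidPDE.timeDerivWithin (Icc 0 T) G t x‖ₑ ^ 2 ≤
      ((Real.toNNReal ((2 * B) ^ 2) * C : ℝ≥0) : ℝ≥0∞) := by
    intro t ht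
    simp only [one_mul]
    have := lintegral_enorm_sq_le_of_abs_le (hG'b t ht) (hCt0 t ht)
    have e : ((((2 * B) ^ 2).toNNReal * C : ℝ≥0) : ℝ≥0∞) = ENNReal.ofReal ((2 * B) ^ 2) * C := by
      rw [ENNReal.coe_mul]; rfl
    rw [e]; exact this
  obtain ⟨hI, hC, hE⟩ := Wei2016.weighted_sq_balance hT hGsm measurable_const hC₀ hC₁
  -- identification of the integrands
  have hdens : ∀ t ∈ Icc 0 T, (fun x => 2 * ((1 : ℝ) * G t x) * ((1 : ℝ) * FluidPDE.timeDerivWithin (Icc 0 T) G t x)) =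
      fun x : EuclideanSpace ℝ (Fin 3) => 4 * ((x 0 ^ 2 + x 1 ^ 2) ^ 2 * angVelQuot (u t) x ^ 3 *
        angVelQuot (FluidPDE.timeDerivWithin (Icc 0 T) u t) x) := by
    intro t ht; funext x; rw [hG' t ht x]; simp only [hG]; ring
  have hen : ∀ t, (fun x => ((1 : ℝ) * G t x) ^ 2) =
      fun x : EuclideanSpace ℝ (Fin 3) => (x 0 ^ 2 + x 1 ^ 2) ^ 2 * angVelQuot (u t) x ^ 4 := by
    intro t; funext x; simp only [hG]; ring
  refine ⟨?_, ?_, ?_⟩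
  · refine hI.congr_fun (fun t ht => ?_) measurableSet_Ioo
    simp only
    rw [hdens t (Ioo_subset_Icc_self ht)]
  · refine hC.congr fun t _ => ?_
    simp only
    rw [hen t]
  · intro b hb
    have := hE b hb
    simp only [hen] at this
    rw [this]
    congr 1
    refine intervalIntegral.integral_congr fun t ht => ?_
    have ht' : t ∈ Icc 0 T := by
      rw [uIcc_of_le hb.1.le] at ht
      exact ⟨ht.1, ht.2.trans hb.2⟩
    simp only
    rw [hdens t ht']

set_option maxHeartbeats 800000 in
/-- **Continuity of `P₄(t) = ∫ (x₀²+x₁²)Φ(t)⁴ = ‖r⁻¹(v^θ)²‖²`** on `[0, T]` in Tao's class, and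
integrability of its integrand at each time. [cite: LeiZhang2017, §3 p. 9] -/
theorem IsTaoSolutionOn.continuousOn_rhoPhiFour (h : IsTaoSolutionOn T ν u₀ u p) (hT : 0 < T)
    (hax : ∀ t ∈ Icc 0 T, IsAxisymmetric (u t)) :
    ContinuousOn (fun t => ∫ x : EuclideanSpace ℝ (Fin 3), (x 0 ^ 2 + x 1 ^ 2) * angVelQuot (u t) x ^ 4) (Icc 0 T) ∧
    ∀ t ∈ Icc 0 T, Integrable (fun x : EuclideanSpace ℝ (Fin 3) => (x 0 ^ 2 + x 1 ^ 2) * angVelQuot (u t) x ^ 4) volume := by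
  have hU : UniqueDiffOn ℝ (Icc 0 T) := uniqueDiffOn_Icc hT
  have hcv : Convex ℝ (Icc (0 : ℝ) T) := convex_Icc 0 T
  have hcl := h.classical
  have hsm : IsSmoothSpaceTimeOn (Icc 0 T) u := hcl.smooth_velocity
  have hΦf : IsSmoothSpaceTimeOn (Icc 0 T) fun t => angVelQuot (u t) := hsm.angVelQuot_family hcv hU
  have hΦ' : ∀ t ∈ Icc 0 T, ∀ x, FluidPDE.timeDerivWithin (Icc 0 T) (fun s => angVelQuot (u s)) t x =
      angVelQuot (FluidPDE.timeDerivWithin (Icc 0 T) u t) x := fun t ht x =>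
    hsm.timeDerivWithin_angVelQuot hcv hU hax ht x
  set G : ℝ → EuclideanSpace ℝ (Fin 3) → ℝ := fun t x => angVelQuot (u t) x * angVelQuot (u t) x with hG
  have hGsm : IsSmoothSpaceTimeOn (Icc 0 T) G := hΦf.mul hΦf
  have hG' : ∀ t ∈ Icc 0 T, ∀ x, FluidPDE.timeDerivWithin (Icc 0 T) G t x =
      2 * angVelQuot (u t) x * angVelQuot (FluidPDE.timeDerivWithin (Icc 0 T) u t) x := by
    intro t ht x
    have hd := hΦf.hasDerivWithinAt_timeDerivWithin hU ht x
    rw [hΦ' t ht x] at hd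
    have h2 : HasDerivWithinAt (fun s => angVelQuot (u s) x * angVelQuot (u s) x)
        (angVelQuot (FluidPDE.timeDerivWithin (Icc 0 T) u t) x * angVelQuot (u t) x +
          angVelQuot (u t) x * angVelQuot (FluidPDE.timeDerivWithin (Icc 0 T) u t) x) (Icc 0 T) t := hd.mul hd
    rw [timeDerivWithin_apply, h2.derivWithin (hU t ht)]
    ring
  obtain ⟨B, hB0, hB⟩ := h.exists_bound_velocity
  obtain ⟨C, -, hC1, -, hCt1⟩ := h.exists_lintegral_sq_le_four
  have hws : ∀ t ∈ Icc 0 T, ContDiff ℝ 2 (FluidPDE.timeDerivWithin (Icc 0 T) u t) := fun t ht =>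
    (hsm.contDiff_timeDerivWithin_slice hU ht).of_le (by norm_cast)
  have hwax : ∀ t ∈ Icc 0 T, IsAxisymmetric (FluidPDE.timeDerivWithin (Icc 0 T) u t) := fun t ht =>
    hsm.isAxisymmetric_timeDerivWithin hax ht
  have hu2 : ∀ t ∈ Icc 0 T, ContDiff ℝ 2 (u t) := fun t ht => (hcl.contDiff_velocity ht).of_le (by norm_cast)
  have hrΦ : ∀ t ∈ Icc 0 T, ∀ x, cylRadius x * |angVelQuot (u t) x| ≤ B := fun t ht x =>
    ((hax t ht).cylRadius_mul_abs_angVelQuot_le (hu2 t ht) x).trans (hB t ht x)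
  have hGb : ∀ t ∈ Icc 0 T, ∀ x, |cylRadius x * G t x| ≤ B * ‖fderiv ℝ (u t) x‖ := by
    intro t ht x
    have h1 := hrΦ t ht x
    have h2 := (hax t ht).abs_angVelQuot_le_norm_fderiv (hu2 t ht) x
    simp only [hG]
    rw [← mul_assoc, abs_mul, abs_mul, abs_of_nonneg (cylRadius_nonneg x)]
    exact mul_le_mul h1 h2 (abs_nonneg _) hB0
  have hG'b : ∀ t ∈ Icc 0 T, ∀ x, |cylRadius x * FluidPDE.timeDerivWithin (Icc 0 T) G t x| ≤
      (2 * B) * ‖fderiv ℝ (FluidPDE.timeDerivWithin (Icc 0 T) u t) x‖ := by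
    intro t ht x
    rw [hG' t ht x]
    have h1 := hrΦ t ht x
    have h2 := (hwax t ht).abs_angVelQuot_le_norm_fderiv (hws t ht) x
    have : cylRadius x * (2 * angVelQuot (u t) x * angVelQuot (FluidPDE.timeDerivWithin (Icc 0 T) u t) x) =
        2 * (cylRadius x * angVelQuot (u t) x) * angVelQuot (FluidPDE.timeDerivWithin (Icc 0 T) u t) x := by ring
    rw [this, abs_mul, abs_mul, abs_mul, abs_two, abs_of_nonneg (cylRadius_nonneg x)]
    exact mul_le_mul (mul_le_mul_of_nonneg_left h1 zero_le_two) h2 (abs_nonneg _) (by positivity)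
  have hC₀ : ∀ t ∈ Icc 0 T, ∫⁻ x, ‖cylRadius x * G t x‖ₑ ^ 2 ≤ ((Real.toNNReal (B ^ 2) * C : ℝ≥0) : ℝ≥0∞) := by
    intro t ht
    have := lintegral_enorm_sq_le_of_abs_le (hGb t ht) (hC1 t ht)
    have e : (((B ^ 2).toNNReal * C : ℝ≥0) : ℝ≥0∞) = ENNReal.ofReal (B ^ 2) * C := by
      rw [ENNReal.coe_mul]; rfl
    rw [e]; exact this
  have hC₁ : ∀ t ∈ Icc 0 T, ∫⁻ x, ‖cylRadius x * FluidPDE.timeDerivWithin (Icc 0 T) G t x‖ₑ ^ 2 ≤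
      ((Real.toNNReal ((2 * B) ^ 2) * C : ℝ≥0) : ℝ≥0∞) := by
    intro t ht
    have := lintegral_enorm_sq_le_of_abs_le (hG'b t ht) (hCt1 t ht)
    have e : ((((2 * B) ^ 2).toNNReal * C : ℝ≥0) : ℝ≥0∞) = ENNReal.ofReal ((2 * B) ^ 2) * C := by
      rw [ENNReal.coe_mul]; rfl
    rw [e]; exact this
  obtain ⟨_, hC, _⟩ := Wei2016.weighted_sq_balance hT hGsm continuous_cylRadius.measurable hC₀ hC₁
  have hen : ∀ t, (fun x => (cylRadius x * G t x) ^ 2) =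
      fun x : EuclideanSpace ℝ (Fin 3) => (x 0 ^ 2 + x 1 ^ 2) * angVelQuot (u t) x ^ 4 := by
    intro t; funext x; simp only [hG]; rw [mul_pow, cylRadius_sq]; ring
  refine ⟨hC.congr fun t _ => by simp only; rw [hen t], fun t ht => ?_⟩
  have hm : MemLp (fun x => cylRadius x * G t x) 2 volume :=
    memLp_two_of_lintegral_sq_le_coe (continuous_cylRadius.mul (hGsm.contDiff_slice ht).continuous) (hC₀ t ht)
  have := hm.integrable_sq
  rw [hen t] at this
  exact this

set_option maxHeartbeats 800000 in
/-- **The `‖ω^θ‖²_{L²}` balance in Tao's class**: with `Ω(t) = angVortQuot (u t)`,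
`Ω'(t) = angVortQuot (∂ₜu t)`, the function `E_ω(t) = ∫ (x₀²+x₁²)Ω(t)²` is continuous on
`[0, T]`, its density `∫ 2(x₀²+x₁²)ΩΩ'` is integrable on `(0, T)`,
`E_ω(b) = E_ω(0) + ∫₀ᵇ ∫ 2(x₀²+x₁²)ΩΩ'` for `b ∈ (0, T]`, and the integrand of `E_ω(t)` is
integrable at each time. [cite: LeiZhang2017, §3 p. 9] -/
theorem IsTaoSolutionOn.omegaTheta_balance (h : IsTaoSolutionOn T ν u₀ u p) (hT : 0 < T)
    (hax : ∀ t ∈ Icc 0 T, IsAxisymmetric (u t)) :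
    IntegrableOn (fun t => ∫ x : EuclideanSpace ℝ (Fin 3), 2 * ((x 0 ^ 2 + x 1 ^ 2) * angVortQuot (u t) x *
        angVortQuot (FluidPDE.timeDerivWithin (Icc 0 T) u t) x)) (Ioo 0 T) ∧
    ContinuousOn (fun t => ∫ x : EuclideanSpace ℝ (Fin 3), (x 0 ^ 2 + x 1 ^ 2) * angVortQuot (u t) x ^ 2) (Icc 0 T) ∧
    (∀ b ∈ Ioc 0 T, ∫ x : EuclideanSpace ℝ (Fin 3), (x 0 ^ 2 + x 1 ^ 2) * angVortQuot (u b) x ^ 2 =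
      (∫ x : EuclideanSpace ℝ (Fin 3), (x 0 ^ 2 + x 1 ^ 2) * angVortQuot (u 0) x ^ 2) +
        ∫ t in (0 : ℝ)..b, ∫ x : EuclideanSpace ℝ (Fin 3), 2 * ((x 0 ^ 2 + x 1 ^ 2) * angVortQuot (u t) x *
          angVortQuot (FluidPDE.timeDerivWithin (Icc 0 T) u t) x)) ∧
    ∀ t ∈ Icc 0 T, Integrable (fun x : EuclideanSpace ℝ (Fin 3) => (x 0 ^ 2 + x 1 ^ 2) * angVortQuot (u t) x ^ 2) volume := by
  have hU : UniqueDiffOn ℝ (Icc 0 T) := uniqueDiffOn_Icc hT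
  have hcv : Convex ℝ (Icc (0 : ℝ) T) := convex_Icc 0 T
  have hIcl : Icc 0 T ⊆ closure (interior (Icc 0 T)) := Icc_subset_closure_interior_Icc' hT
  have hcl := h.classical
  have hsm : IsSmoothSpaceTimeOn (Icc 0 T) u := hcl.smooth_velocity
  have hΩf : IsSmoothSpaceTimeOn (Icc 0 T) fun t => angVortQuot (u t) := hsm.angVortQuot_family hcv hU
  have hΩ' : ∀ t ∈ Icc 0 T, ∀ x, FluidPDE.timeDerivWithin (Icc 0 T) (fun s => angVortQuot (u s)) t x =
      angVortQuot (FluidPDE.timeDerivWithin (Icc 0 T) u t) x := fun t ht x =>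
    hsm.timeDerivWithin_angVortQuot hcv hU hIcl hax ht x
  obtain ⟨C, -, hC1, -, hCt1⟩ := h.exists_lintegral_sq_le_four
  have hws : ∀ t ∈ Icc 0 T, ContDiff ℝ 3 (FluidPDE.timeDerivWithin (Icc 0 T) u t) := fun t ht =>
    (hsm.contDiff_timeDerivWithin_slice hU ht).of_le (by norm_cast)
  have hwax : ∀ t ∈ Icc 0 T, IsAxisymmetric (FluidPDE.timeDerivWithin (Icc 0 T) u t) := fun t ht =>
    hsm.isAxisymmetric_timeDerivWithin hax ht
  have hu3 : ∀ t ∈ Icc 0 T, ContDiff ℝ 3 (u t) := fun t ht => (hcl.contDiff_velocity ht).of_le (by norm_cast)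
  set c : ℝ := ‖(curlCLM : (EuclideanSpace ℝ (Fin 3) →L[ℝ] EuclideanSpace ℝ (Fin 3)) →L[ℝ]
      EuclideanSpace ℝ (Fin 3))‖ with hc_def
  have hGb : ∀ t ∈ Icc 0 T, ∀ x, |cylRadius x * angVortQuot (u t) x| ≤ c * ‖fderiv ℝ (u t) x‖ := by
    intro t ht x
    rw [abs_mul, abs_of_nonneg (cylRadius_nonneg x)]
    exact ((hax t ht).cylRadius_mul_abs_angVortQuot_le (hu3 t ht) x).trans (norm_curl_le_norm_curlCLM_mul (u t) x)
  have hG'b : ∀ t ∈ Icc 0 T, ∀ x, |cylRadius x * FluidPDE.timeDerivWithin (Icc 0 T) (fun s => angVortQuot (u s)) t x| ≤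
      c * ‖fderiv ℝ (FluidPDE.timeDerivWithin (Icc 0 T) u t) x‖ := by
    intro t ht x
    rw [hΩ' t ht x, abs_mul, abs_of_nonneg (cylRadius_nonneg x)]
    exact ((hwax t ht).cylRadius_mul_abs_angVortQuot_le (hws t ht) x).trans
      (norm_curl_le_norm_curlCLM_mul (FluidPDE.timeDerivWithin (Icc 0 T) u t) x)
  have hC₀ : ∀ t ∈ Icc 0 T, ∫⁻ x, ‖cylRadius x * angVortQuot (u t) x‖ₑ ^ 2 ≤ ((Real.toNNReal (c ^ 2) * C : ℝ≥0) : ℝ≥0∞) := by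
    intro t ht
    have := lintegral_enorm_sq_le_of_abs_le (hGb t ht) (hC1 t ht)
    have e : (((c ^ 2).toNNReal * C : ℝ≥0) : ℝ≥0∞) = ENNReal.ofReal (c ^ 2) * C := by
      rw [ENNReal.coe_mul]; rfl
    rw [e]; exact this
  have hC₁ : ∀ t ∈ Icc 0 T, ∫⁻ x, ‖cylRadius x * FluidPDE.timeDerivWithin (Icc 0 T) (fun s => angVortQuot (u s)) t x‖ₑ ^ 2 ≤
      ((Real.toNNReal (c ^ 2) * C : ℝ≥0) : ℝ≥0∞) := by
    intro t ht
    have := lintegral_enorm_sq_le_of_abs_le (hG'b t ht) (hCt1 t ht)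
    have e : (((c ^ 2).toNNReal * C : ℝ≥0) : ℝ≥0∞) = ENNReal.ofReal (c ^ 2) * C := by
      rw [ENNReal.coe_mul]; rfl
    rw [e]; exact this
  obtain ⟨hI, hC, hE⟩ := Wei2016.weighted_sq_balance hT hΩf continuous_cylRadius.measurable hC₀ hC₁
  have hdens : ∀ t ∈ Icc 0 T, (fun x => 2 * (cylRadius x * angVortQuot (u t) x) *
      (cylRadius x * FluidPDE.timeDerivWithin (Icc 0 T) (fun s => angVortQuot (u s)) t x)) =
      fun x : EuclideanSpace ℝ (Fin 3) => 2 * ((x 0 ^ 2 + x 1 ^ 2) * angVortQuot (u t) x *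
        angVortQuot (FluidPDE.timeDerivWithin (Icc 0 T) u t) x) := by
    intro t ht; funext x; rw [hΩ' t ht x, ← cylRadius_sq]; ring
  have hen : ∀ t, (fun x => (cylRadius x * angVortQuot (u t) x) ^ 2) =
      fun x : EuclideanSpace ℝ (Fin 3) => (x 0 ^ 2 + x 1 ^ 2) * angVortQuot (u t) x ^ 2 := by
    intro t; funext x; rw [mul_pow, cylRadius_sq]
  refine ⟨?_, ?_, ?_, ?_⟩
  · refine hI.congr_fun (fun t ht => ?_) measurableSet_Ioo
    simp only
    rw [hdens t (Ioo_subset_Icc_self ht)]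
  · refine hC.congr fun t _ => ?_
    simp only
    rw [hen t]
  · intro b hb
    have := hE b hb
    simp only [hen] at this
    rw [this]
    congr 1
    refine intervalIntegral.integral_congr fun t ht => ?_
    have ht' : t ∈ Icc 0 T := by
      rw [uIcc_of_le hb.1.le] at ht
      exact ⟨ht.1, ht.2.trans hb.2⟩
    simp only
    rw [hdens t ht']
  · intro t ht
    have hm : MemLp (fun x => cylRadius x * angVortQuot (u t) x) 2 volume :=
      memLp_two_of_lintegral_sq_le_coe (continuous_cylRadius.mul (hΩf.contDiff_slice ht).continuous) (hC₀ t ht)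
    have := hm.integrable_sq
    rw [hen t] at this
    exact this

/-- **Integrability of `(x₀²+x₁²)²Φ(t)⁴` at each time** in Tao's class (`= (v^θ)⁴ ∈ L¹`).
[cite: LeiZhang2017, §3 p. 9] -/
theorem IsTaoSolutionOn.integrable_rhoSq_angVelQuot_four (h : IsTaoSolutionOn T ν u₀ u p)
    (hax : ∀ t ∈ Icc 0 T, IsAxisymmetric (u t)) {t : ℝ} (ht : t ∈ Icc 0 T) :
    Integrable (fun x : EuclideanSpace ℝ (Fin 3) => (x 0 ^ 2 + x 1 ^ 2) ^ 2 * angVelQuot (u t) x ^ 4) volume := by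
  have hcl := h.classical
  have hu2 : ContDiff ℝ 2 (u t) := (hcl.contDiff_velocity ht).of_le (by norm_cast)
  obtain ⟨B, hB0, hB⟩ := h.exists_bound_velocity
  obtain ⟨C, hC0, -, -, -⟩ := h.exists_lintegral_sq_le_four
  have hΦc : Continuous (angVelQuot (u t)) := (contDiff_angVelQuot_of_contDiff (hcl.contDiff_velocity ht)).continuous
  have hGb : ∀ x : EuclideanSpace ℝ (Fin 3), |(x 0 ^ 2 + x 1 ^ 2) * angVelQuot (u t) x ^ 2| ≤ B * ‖u t x‖ := by
    intro x
    have h1 := (hax t ht).horizSq_mul_angVelQuot_sq_le hu2 x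
    have h2 : (x 0 ^ 2 + x 1 ^ 2) * angVelQuot (u t) x ^ 2 ≤ B ^ 2 :=
      h1.trans (pow_le_pow_left₀ (norm_nonneg _) (hB t ht x) 2)
    have ha0 : 0 ≤ (x 0 ^ 2 + x 1 ^ 2) * angVelQuot (u t) x ^ 2 := by positivity
    rw [abs_of_nonneg ha0]
    have hsq : ((x 0 ^ 2 + x 1 ^ 2) * angVelQuot (u t) x ^ 2) ^ 2 ≤ (B * ‖u t x‖) ^ 2 := by
      rw [mul_pow B, pow_two ((x 0 ^ 2 + x 1 ^ 2) * angVelQuot (u t) x ^ 2)]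
      exact mul_le_mul h2 h1 ha0 (sq_nonneg _)
    exact (pow_le_pow_iff_left₀ ha0 (by positivity) two_ne_zero).1 hsq
  have hC₀ : ∫⁻ x : EuclideanSpace ℝ (Fin 3), ‖(x 0 ^ 2 + x 1 ^ 2) * angVelQuot (u t) x ^ 2‖ₑ ^ 2 ≤
      ((Real.toNNReal (B ^ 2) * C : ℝ≥0) : ℝ≥0∞) := by
    have := lintegral_enorm_sq_le_of_abs_le hGb (hC0 t ht)
    have e : (((B ^ 2).toNNReal * C : ℝ≥0) : ℝ≥0∞) = ENNReal.ofReal (B ^ 2) * C := by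
      rw [ENNReal.coe_mul]; rfl
    rw [e]; exact this
  have hm : MemLp (fun x : EuclideanSpace ℝ (Fin 3) => (x 0 ^ 2 + x 1 ^ 2) * angVelQuot (u t) x ^ 2) 2 volume :=
    memLp_two_of_lintegral_sq_le_coe ((contDiff_horizSq (n := 0)).continuous.mul (hΦc.pow 2)) hC₀
  exact hm.integrable_sq.congr (ae_of_all _ fun x => by simp only; ring)

end Literature.Analysis.FluidPDE

end
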